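import Mathlib
import Summits.Ventures.HodgeRepro.Tier4.Target

/-!
# Tier4/Common/TargetBall — the ball model of the frozen target: `U(2,1)` preserves the ball, `actM` is an action,
the transfer `toBallMat` is a homomorphism into `U(2,1)`

Blind re-derivation cell `pub-hodge-repro`, Tier 4 (README §9–§10), seat t4-typer-2 (gen 0).  Target tree path
`lean/Summits/Ventures/HodgeRepro/Tier4/Common/TargetBall.lean`.  Imports the FROZEN `Tier4/Target.lean` only and
proves lemmas ABOUT its §0 / §C definitions (`J`, `nsq`, `lift3`, `actM`, `ball`, `toBallMat`, `cstar`,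
`IsUnitaryOf`, `IsSylvester`) — the facts the sealed `BallModel.lean` proves for its own `U21` / `Ball` / `act`,
re-proved here for the target's standalone definitions (the sealed oleans are not served to the seats).

WHAT IS PROVED (Mathlib only):
* `quadJ w = ‖w₀‖² + ‖w₁‖² − ‖w₂‖²` is the form `w̄ᵀ J w` (`star_dotProduct_J_mulVec`); it is preserved by every
  `M` with `Mᴴ J M = J` (`quadJ_mulVec`), scales by `‖c‖²` under `c • w` (`quadJ_smul`), and is negative exactly on
  the lifts of the ball (`quadJ_lift3`, `mem_ball_iff_quadJ_lift3`), where the third coordinate is non-zero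
  (`two_ne_zero_of_quadJ_neg`);
* for `M ∈ U(2,1)` and `z` in the ball: the denominator `(M (z,1))₂ ≠ 0` (`mulVec_lift3_two_ne_zero`), the lift
  of the image is the normalised image (`lift3_actM`), the ball is preserved (`actM_mem_ball`), and the action is
  an ACTION: `actM (M * N) z = actM M (actM N z)` (`actM_mul`), `actM 1 z = z` (`actM_one'`); the action map is
  holomorphic on the ball (`differentiableOn_actM`, `continuousOn_actM`);
* the transfer `M(g) = C⁻¹ τ₀(g) C` is multiplicative (`toBallMat_mul`) and lands in `U(2,1)` for `g ∈ U(H)`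
  (`toBallMat_J`): with `Cᴴ τ₀(H) C = ±J` the sign squares away, so BOTH Sylvester signs give `M(g)ᴴ J M(g) = J`;
  the CM-field input is `τ₀ ∘ c = conj ∘ τ₀` for the complex conjugation `c` of the CM field (Mathlib
  `IsCMField.complexEmbedding_complexConj`, `complexConj_intertwines`).

Nothing here says anything about the status of the Hodge conjecture for CM abelian varieties, which is NOT proved
(HC_CM is NOT proved by anyone in this repository).
-/

set_option autoImplicit false

noncomputable section

namespace Summit.Ventures.HodgeRepro.Tier4

open Matrix Complex
open scoped ComplexConjugate

/-! ## 1. The form `w̄ᵀ J w` -/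

/-- `quadJ w = ‖w₀‖² + ‖w₁‖² − ‖w₂‖²` (the sealed `BallModel.Q`). -/
def quadJ (w : Fin 3 → ℂ) : ℝ := ‖w 0‖ ^ 2 + ‖w 1‖ ^ 2 - ‖w 2‖ ^ 2

/-- `w̄ᵀ J w = quadJ w`. -/
theorem star_dotProduct_J_mulVec (w : Fin 3 → ℂ) : star w ⬝ᵥ (J *ᵥ w) = ((quadJ w : ℝ) : ℂ) := by
  have h0 := Complex.conj_mul' (w 0)
  have h1 := Complex.conj_mul' (w 1)
  have h2 := Complex.conj_mul' (w 2)
  simp only [J, mulVec_diagonal, dotProduct, Fin.sum_univ_three, Pi.star_apply, Complex.star_def, quadJ,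
    Matrix.cons_val_zero, Matrix.cons_val_one, Matrix.cons_val]
  push_cast
  linear_combination h0 + h1 - h2

/-- A matrix preserving `J` preserves the form. -/
theorem star_dotProduct_J_mulVec_mulVec {M : Matrix (Fin 3) (Fin 3) ℂ} (hM : Mᴴ * J * M = J) (w : Fin 3 → ℂ) :
    star (M *ᵥ w) ⬝ᵥ (J *ᵥ (M *ᵥ w)) = star w ⬝ᵥ (J *ᵥ w) := by
  rw [Matrix.star_mulVec, Matrix.mulVec_mulVec, Matrix.dotProduct_mulVec, Matrix.vecMul_vecMul,
    ← Matrix.mul_assoc, hM, ← Matrix.dotProduct_mulVec]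

/-- `quadJ (M w) = quadJ w` for `M ∈ U(2,1)`. -/
theorem quadJ_mulVec {M : Matrix (Fin 3) (Fin 3) ℂ} (hM : Mᴴ * J * M = J) (w : Fin 3 → ℂ) :
    quadJ (M *ᵥ w) = quadJ w := by
  have := star_dotProduct_J_mulVec_mulVec hM w
  rw [star_dotProduct_J_mulVec, star_dotProduct_J_mulVec] at this
  exact_mod_cast this

/-- `quadJ (c • w) = ‖c‖² quadJ w`. -/
theorem quadJ_smul (c : ℂ) (w : Fin 3 → ℂ) : quadJ (c • w) = ‖c‖ ^ 2 * quadJ w := by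
  simp only [quadJ, Pi.smul_apply, smul_eq_mul, norm_mul, mul_pow]
  ring

/-- `quadJ (z, 1) = |z₀|² + |z₁|² − 1`. -/
theorem quadJ_lift3 (z : Fin 2 → ℂ) : quadJ (lift3 z) = nsq z - 1 := by
  simp [quadJ, lift3, nsq]

/-- `z` is in the ball iff `(z, 1)` is `J`-negative. -/
theorem mem_ball_iff_quadJ_lift3 (z : Fin 2 → ℂ) : z ∈ ball ↔ quadJ (lift3 z) < 0 := by
  rw [quadJ_lift3]; simp [ball]

/-- A `J`-negative vector has non-zero third coordinate. -/
theorem two_ne_zero_of_quadJ_neg {w : Fin 3 → ℂ} (hw : quadJ w < 0) : w 2 ≠ 0 := by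
  intro h
  simp only [quadJ, h, norm_zero] at hw
  nlinarith [sq_nonneg ‖w 0‖, sq_nonneg ‖w 1‖]

/-! ## 2. The action of `U(2,1)` on the ball -/

section Action

variable {M N : Matrix (Fin 3) (Fin 3) ℂ} {z : Fin 2 → ℂ}

/-- For `M ∈ U(2,1)` and `z` in the ball the denominator of the action is non-zero. -/
theorem mulVec_lift3_two_ne_zero (hM : Mᴴ * J * M = J) (hz : z ∈ ball) : (M *ᵥ lift3 z) 2 ≠ 0 :=
  two_ne_zero_of_quadJ_neg (by rw [quadJ_mulVec hM]; exact (mem_ball_iff_quadJ_lift3 z).mp hz)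

/-- Whenever the denominator is non-zero, the lift of `actM M z` is the normalised `M (z, 1)`. -/
theorem lift3_actM (h : (M *ᵥ lift3 z) 2 ≠ 0) :
    lift3 (actM M z) = ((M *ᵥ lift3 z) 2)⁻¹ • (M *ᵥ lift3 z) := by
  funext i
  fin_cases i
  · show (M *ᵥ lift3 z) 0 / (M *ᵥ lift3 z) 2 = ((M *ᵥ lift3 z) 2)⁻¹ * (M *ᵥ lift3 z) 0
    rw [div_eq_inv_mul]
  · show (M *ᵥ lift3 z) 1 / (M *ᵥ lift3 z) 2 = ((M *ᵥ lift3 z) 2)⁻¹ * (M *ᵥ lift3 z) 1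
    rw [div_eq_inv_mul]
  · show (1 : ℂ) = ((M *ᵥ lift3 z) 2)⁻¹ * (M *ᵥ lift3 z) 2
    rw [inv_mul_cancel₀ h]

/-- `U(2,1)` preserves the ball. -/
theorem actM_mem_ball (hM : Mᴴ * J * M = J) (hz : z ∈ ball) : actM M z ∈ ball := by
  have h2 := mulVec_lift3_two_ne_zero hM hz
  rw [mem_ball_iff_quadJ_lift3, lift3_actM h2, quadJ_smul, quadJ_mulVec hM]
  have hneg := (mem_ball_iff_quadJ_lift3 z).mp hz
  have hpos : 0 < ‖((M *ᵥ lift3 z) 2)⁻¹‖ ^ 2 := by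
    have : ((M *ᵥ lift3 z) 2)⁻¹ ≠ 0 := inv_ne_zero h2
    positivity
  exact mul_neg_of_pos_of_neg hpos hneg

/-- `actM` is an action on the ball: `actM (M N) z = actM M (actM N z)` for `N ∈ U(2,1)` (any `M`). -/
theorem actM_mul (hN : Nᴴ * J * N = J) (hz : z ∈ ball) :
    actM (M * N) z = actM M (actM N z) := by
  have hN2 := mulVec_lift3_two_ne_zero hN hz
  funext k
  simp only [actM]
  rw [lift3_actM hN2, Matrix.mulVec_smul, ← Matrix.mulVec_mulVec, Pi.smul_apply, Pi.smul_apply, smul_eq_mul,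
    smul_eq_mul, mul_div_mul_left _ _ (inv_ne_zero hN2)]

/-- The identity acts trivially (restated from `actM_one` of `TargetCalculus` for independence). -/
theorem actM_one' (z : Fin 2 → ℂ) : actM 1 z = z := by
  funext k
  simp only [actM, Matrix.one_mulVec]
  rw [show lift3 z 2 = 1 from rfl, div_one]
  fin_cases k <;> rfl

/-- The coordinates of `M (z, 1)` are affine in `z`. -/
theorem mulVec_lift3_apply (M : Matrix (Fin 3) (Fin 3) ℂ) (z : Fin 2 → ℂ) (i : Fin 3) :
    (M *ᵥ lift3 z) i = M i 0 * z 0 + M i 1 * z 1 + M i 2 := by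
  simp [Matrix.mulVec, dotProduct, Fin.sum_univ_three, lift3]

/-- `z ↦ (M (z,1))ᵢ` is holomorphic on `ℂ²`. -/
theorem differentiable_mulVec_lift3 (M : Matrix (Fin 3) (Fin 3) ℂ) (i : Fin 3) :
    Differentiable ℂ fun z : Fin 2 → ℂ => (M *ᵥ lift3 z) i := by
  have : (fun z : Fin 2 → ℂ => (M *ᵥ lift3 z) i) = fun z => M i 0 * z 0 + M i 1 * z 1 + M i 2 := by
    funext z; exact mulVec_lift3_apply M z i
  rw [this]
  fun_prop

/-- The action map is holomorphic on the ball for `M ∈ U(2,1)`. -/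
theorem differentiableOn_actM (hM : Mᴴ * J * M = J) : DifferentiableOn ℂ (actM M) ball := by
  rw [differentiableOn_pi]
  intro k
  have hnum : DifferentiableOn ℂ (fun z : Fin 2 → ℂ => (M *ᵥ lift3 z) (Fin.castSucc k)) ball :=
    (differentiable_mulVec_lift3 M _).differentiableOn
  have hden : DifferentiableOn ℂ (fun z : Fin 2 → ℂ => (M *ᵥ lift3 z) 2) ball :=
    (differentiable_mulVec_lift3 M 2).differentiableOn
  have : (fun z => actM M z k) =
      fun z => (M *ᵥ lift3 z) (Fin.castSucc k) * ((M *ᵥ lift3 z) 2)⁻¹ := by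
    funext z; exact div_eq_mul_inv _ _
  rw [this]
  exact hnum.mul (hden.inv fun z hz => mulVec_lift3_two_ne_zero hM hz)

/-- The action map is continuous on the ball for `M ∈ U(2,1)`. -/
theorem continuousOn_actM (hM : Mᴴ * J * M = J) : ContinuousOn (actM M) ball :=
  (differentiableOn_actM hM).continuousOn

end Action

/-! ## 3. The transfer `g ↦ M(g) = C⁻¹ τ₀(g) C` -/

section Transfer

variable {E : Type*} [Field E] (τ₀ : E →+* ℂ) {C : Matrix (Fin 3) (Fin 3) ℂ}

/-- The transfer is multiplicative for an invertible `C`. -/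
theorem toBallMat_mul (hC : IsUnit C) (g h : Matrix (Fin 3) (Fin 3) E) :
    toBallMat τ₀ C (g * h) = toBallMat τ₀ C g * toBallMat τ₀ C h := by
  have hCC : C * C⁻¹ = 1 := Matrix.mul_nonsing_inv C ((Matrix.isUnit_iff_isUnit_det C).mp hC)
  simp only [toBallMat, Matrix.map_mul]
  calc C⁻¹ * (g.map τ₀ * h.map τ₀) * C = C⁻¹ * g.map τ₀ * (C * C⁻¹) * h.map τ₀ * C := by
        rw [hCC, Matrix.mul_one]; simp only [Matrix.mul_assoc]
    _ = C⁻¹ * g.map τ₀ * C * (C⁻¹ * h.map τ₀ * C) := by simp only [Matrix.mul_assoc]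

/-- `(τ₀(g))ᴴ = τ₀(c(g)ᵀ)` when `τ₀ ∘ c = conj ∘ τ₀`. -/
theorem conjTranspose_map (c : E ≃+* E) (hτ : ∀ x, τ₀ (c x) = conj (τ₀ x)) (g : Matrix (Fin 3) (Fin 3) E) :
    (g.map τ₀)ᴴ = (cstar c g).map τ₀ := by
  ext i j
  simp [Matrix.conjTranspose_apply, cstar, Matrix.map_apply, Matrix.transpose_apply, hτ]

/-- **The transfer of a unitary matrix lies in `U(2,1)`**: for `H` `c`-hermitian, `g ∈ U(H)`, `C` a Sylvester
matrix (`Cᴴ τ₀(H) C = ±J`) and `τ₀ ∘ c = conj ∘ τ₀`, `M(g)ᴴ J M(g) = J`. -/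
theorem toBallMat_J (c : E ≃+* E) (hτ : ∀ x, τ₀ (c x) = conj (τ₀ x)) {H : Matrix (Fin 3) (Fin 3) E}
    (hC : IsSylvester (H.map τ₀) C) {g : Matrix (Fin 3) (Fin 3) E} (hg : IsUnitaryOf c H g) :
    (toBallMat τ₀ C g)ᴴ * J * toBallMat τ₀ C g = J := by
  obtain ⟨hCu, hCJ⟩ := hC
  have hdet : IsUnit C.det := (Matrix.isUnit_iff_isUnit_det C).mp hCu
  have hCC : C * C⁻¹ = 1 := Matrix.mul_nonsing_inv C hdet
  have h1 : Cᴴ⁻¹ * Cᴴ = 1 := by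
    rw [← Matrix.conjTranspose_nonsing_inv, ← Matrix.conjTranspose_mul, hCC, Matrix.conjTranspose_one]
  have hmap : (g.map τ₀)ᴴ * H.map τ₀ * g.map τ₀ = H.map τ₀ := by
    rw [conjTranspose_map τ₀ c hτ, ← Matrix.map_mul, ← Matrix.map_mul]
    unfold IsUnitaryOf at hg
    rw [hg]
  -- with `Cᴴ τ₀(H) C = ε • J`, `ε² = 1`
  have key : ∀ ε : ℂ, ε * ε = 1 → Cᴴ * H.map τ₀ * C = ε • J →
      (toBallMat τ₀ C g)ᴴ * J * toBallMat τ₀ C g = J := by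
    intro ε hε hCJ
    have hJ : J = ε • (Cᴴ * H.map τ₀ * C) := by
      rw [hCJ, smul_smul, hε, one_smul]
    unfold toBallMat
    rw [Matrix.conjTranspose_mul, Matrix.conjTranspose_mul, Matrix.conjTranspose_nonsing_inv]
    conv_lhs => rw [hJ]
    simp only [Matrix.mul_smul, Matrix.smul_mul, Matrix.mul_assoc]
    rw [← Matrix.mul_assoc Cᴴ⁻¹ Cᴴ, h1, Matrix.one_mul, ← Matrix.mul_assoc C C⁻¹, hCC, Matrix.one_mul]
    have h2 : (g.map τ₀)ᴴ * (H.map τ₀ * (g.map τ₀ * C)) = H.map τ₀ * C := by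
      rw [← Matrix.mul_assoc, ← Matrix.mul_assoc, hmap]
    rw [h2, ← Matrix.mul_assoc, hCJ, smul_smul, hε, one_smul]
  rcases hCJ with hCJ | hCJ
  · exact key 1 (one_mul 1) (by rw [hCJ, one_smul])
  · exact key (-1) (by norm_num) (by rw [hCJ, neg_one_smul])

end Transfer

/-- The complex conjugation of a CM field is intertwined with `conj` by every complex embedding
(Mathlib `IsCMField.complexEmbedding_complexConj`). -/
theorem complexConj_intertwines (E : Type*) [Field E] [NumberField E] [NumberField.IsCMField E] (τ₀ : E →+* ℂ)
    (x : E) : τ₀ ((NumberField.IsCMField.complexConj E).toRingEquiv x) = conj (τ₀ x) :=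
  NumberField.IsCMField.complexEmbedding_complexConj E τ₀ x

end Summit.Ventures.HodgeRepro.Tier4

end
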